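import Summits.BirchSwinnertonDyer.BirchSwinnertonDyer.Theorems.CountingDoorF2AtThreeRootNumberTypeI
import HarnessLib

/-!
# BirchSwinnertonDyer / CountingDoorF2AtThree — crux I2 `RootNumberPlusLowerDensityLargeF2`
# (stmt-BirchSwinnertonDyer-19441), lane «closed-form local root numbers»: the «Type I» structure of the Jacobi
# kernel of `F₂` beyond the generic class — the 2-adic general form (odd parts of `c₆, c₄, G, Δ` as data)

Companion of `…RootNumberTypeI.lean` (generic class `a₁` odd, `3 ∤ a₁`, `gcd(a₁, Q) = 1`, where `c₄ ≡ 1 (8)` and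
`c₆, G` are odd). On the other half of the cell's door class (`a₁` even) `c₆ = 8·odd`, `v₂(c₄) ≥ 4` is unbounded
along `a₃` and `G` is even; the same three reciprocities go through with the ODD PARTS `n₆, n₄, n_G` of
`|c₆|, |c₄|, |G|` in place of the absolute values and extra characters `χ₈(·)^{e}` recording the 2-adic exponents
(lane B's kit test j281730 Part D: no dependence on the parity of `v₂(c₄)` beyond these factors, 2 460 780 / 0):

* `jacobiSym_neg_transfer_oddPart` — abstract lemma: `1728Δ = c₄³ − c₆²`, `c₄ ∣ 8a₁²c₆ − G`, `|Δ| = 2^v M`,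
  `|c₆| = 2^{e₆} n₆`, `|c₄| = 2^{e₄} n₄`, `|G| = 2^{e_G} n_G` (`M, n₆, n₄, n_G` odd), `3 ∤ c₆`, `gcd(a₁, n₄) = 1` ⟹
  `J(−c₆ | M) = ε · J(c₄ | n_G)` with `ε` an explicit product of `qrSign`'s, `χ₈`-powers, `J(±1 | ·)`'s, `J(3 | n₆)`;
* `gcd_a₁_oddPart_c₄` — for `a ∈ F₂`: `3 ∤ a₁` and «no odd prime divides both `a₁` and `Q`» give `gcd(a₁, n₄) = 1`;
* `jacobiSym_neg_c₆_eq_typeI_oddPart` — the `F₂` instance (any parity of `a₁`): `J(−c₆(a) | M) = ε(a)·J(c₄(a) | n_G)`,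
  `n_G` the odd part of `|G(a₁,a₂,a₂′)|` (free of `a₃`), `c₄` linear in `a₃`;
* `rootNumber_curve_eq_typeI_oddPart_of_odd` / `_of_even` — on the squarefree locus, modulo Modularity:
  `w(E_a) = −μ(m)·ε(a)·J(c₄(a) | n_G)`.

HONEST STATUS: structure of the sign function only; the crux (a `2/3`-bias weak-Chowla bound for this explicit
function over a congruence class) is OPEN; no S0 motion. PARTITION: none — r_an ≥ 2, summit axis S0; TWIN
(D-0056): n/a. B1 honesty: bookkeeping; nothing reads r_an.

References: D. Rohrlich, *Compositio Math.* 87 (1993) Prop. 2 [Rohrlich1993Compositio]; H. A. Helfgott,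
arXiv:math/0408141 §1 [Helfgott2004RootNumber]; M. Bhargava, W. Ho, arXiv:2207.03309 §1 [BhargavaHo2022].
-/

set_option linter.dupNamespace false
set_option autoImplicit false

noncomputable section

open scoped Classical NumberTheorySymbols

open ZMod WeierstrassCurve
  Literature.NumberTheory.EllipticCurves.BhargavaHo2022
  Summit.BirchSwinnertonDyer.BirchSwinnertonDyer.Theorems.SemistableRootNumber
  Summit.BirchSwinnertonDyer.BirchSwinnertonDyer.Theorems.F2RootNumber

namespace Summit.BirchSwinnertonDyer.BirchSwinnertonDyer.Theorems.F2RootNumber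

/-! ### §1 Elementary Jacobi-symbol bookkeeping (file-local) -/

/-- If `u² = 1` and `u·x = y` then `x = u·y`. [folklore] -/
private theorem eq_mul_of_sq_eq_one {u x y : ℤ} (hu : u ^ 2 = 1) (h : u * x = y) : x = u * y := by
  subst h
  rw [← mul_assoc, ← sq, hu, one_mul]

/-- A Jacobi symbol satisfies `J³ = J` (its values are `0, ±1`). [folklore] -/
private theorem jacobiSym_pow_three (a : ℤ) (b : ℕ) : J(a | b) ^ 3 = J(a | b) := by
  rcases jacobiSym.trichotomy a b with h | h | h <;> rw [h] <;> norm_num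

/-- `χ₈` of an odd natural number squares to `1`. [folklore] -/
private theorem χ₈_sq_eq_one_of_odd {n : ℕ} (hn : Odd n) : (χ₈ (n : ZMod 8)) ^ 2 = 1 := by
  rw [χ₈_nat_eq_if_mod_eight]
  have h2 : n % 2 = 1 := Nat.odd_iff.mp hn
  rw [if_neg (by omega)]
  split_ifs <;> norm_num

/-- For an integer `c ≡ 1 (mod 8)`, `J(2 | |c|) = 1`. [folklore] -/
private theorem jacobiSym_two_natAbs_eq_one {c : ℤ} (hc : c % 8 = 1) : J(2 | c.natAbs) = 1 := by
  have hodd : Odd c.natAbs := Int.natAbs_odd.mpr (Int.odd_iff.mpr (by omega))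
  have h2 : c.natAbs % 2 = 1 := Nat.odd_iff.mp hodd
  have h : c.natAbs % 8 = 1 ∨ c.natAbs % 8 = 7 := by omega
  rw [jacobiSym.at_two hodd, χ₈_nat_eq_if_mod_eight, if_neg (by omega), if_pos h]

/-- `|a| = sign(a)·a` as an integer identity. [folklore] -/
private theorem natAbs_eq_sign_mul (a : ℤ) : (a.natAbs : ℤ) = a.sign * a :=
  (Int.sign_mul_self_eq_natAbs a).symm

/-- `χ₄` of an odd natural number squares to `1`. [folklore] -/
private theorem χ₄_sq_eq_one_of_odd {n : ℕ} (hn : Odd n) : (χ₄ (n : ZMod 4)) ^ 2 = 1 := by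
  rw [χ₄_nat_eq_if_mod_four]
  have h2 : n % 2 = 1 := Nat.odd_iff.mp hn
  rw [if_neg (by omega)]
  split_ifs <;> norm_num

/-- For `c ≠ 0` and `n` odd, `J(sign c | n)² = 1`. [folklore] -/
private theorem jacobiSym_sign_sq {c : ℤ} (hc : c ≠ 0) {n : ℕ} (hn : Odd n) : J(c.sign | n) ^ 2 = 1 := by
  rcases lt_trichotomy c 0 with h | h | h
  · rw [Int.sign_eq_neg_one_of_neg h, jacobiSym.at_neg_one hn, χ₄_sq_eq_one_of_odd hn]
  · exact absurd h hc
  · rw [Int.sign_eq_one_of_pos h, jacobiSym.one_left, one_pow]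

/-! ### §2 The abstract transfer lemma, 2-adic general form -/

/-- General 2-adic version of the transfer lemma: the odd parts of `|c₆|, |c₄|, |G|, |Δ|` are supplied as data
(`|x| = 2^e·n`, `n` odd); no congruence condition on `c₄` modulo `8`. [folklore] -/
theorem jacobiSym_neg_transfer_oddPart {c₄ c₆ Δ G a₁ : ℤ} {M v n₆ e₆ n₄ e₄ nG eG : ℕ}
    (hΔ : 1728 * Δ = c₄ ^ 3 - c₆ ^ 2) (hG : c₄ ∣ 8 * a₁ ^ 2 * c₆ - G)
    (hM : Δ.natAbs = 2 ^ v * M) (hMo : Odd M)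
    (hn₆ : c₆.natAbs = 2 ^ e₆ * n₆) (hn₆o : Odd n₆) (h63 : ¬ (3 : ℤ) ∣ c₆)
    (hn₄ : c₄.natAbs = 2 ^ e₄ * n₄) (hn₄o : Odd n₄)
    (hnG : G.natAbs = 2 ^ eG * nG) (hnGo : Odd nG) (ha : Int.gcd a₁ n₄ = 1) :
    J(-c₆ | M) =
      J(-c₆.sign | M) * (χ₈ M) ^ e₆ * qrSign M n₆ * (χ₈ n₆) ^ v * J(Δ.sign | n₆) * J(3 | n₆) *
        J(c₄.sign | n₆) * (χ₈ n₆) ^ e₄ * qrSign n₆ n₄ * J(c₆.sign | n₄) * (χ₈ n₄) ^ e₆ * χ₈ n₄ *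
        J(G.sign | n₄) * (χ₈ n₄) ^ eG * qrSign n₄ nG * J(c₄.sign | nG) * (χ₈ nG) ^ e₄ * J(c₄ | nG) := by
  -- decompositions `x = sign x · 2^e · n` and non-vanishing
  have d6 : c₆ = c₆.sign * 2 ^ e₆ * (n₆ : ℤ) := by
    conv_lhs => rw [← Int.sign_mul_abs c₆, Int.abs_eq_natAbs, hn₆]
    push_cast
    ring
  have d4 : c₄ = c₄.sign * 2 ^ e₄ * (n₄ : ℤ) := by
    conv_lhs => rw [← Int.sign_mul_abs c₄, Int.abs_eq_natAbs, hn₄]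
    push_cast
    ring
  have dG : G = G.sign * 2 ^ eG * (nG : ℤ) := by
    conv_lhs => rw [← Int.sign_mul_abs G, Int.abs_eq_natAbs, hnG]
    push_cast
    ring
  have h60 : c₆ ≠ 0 := by
    rintro rfl
    simp only [Int.natAbs_zero] at hn₆
    have : n₆ = 0 := by
      rcases mul_eq_zero.mp hn₆.symm with h | h
      · exact absurd h (pow_ne_zero _ two_ne_zero)
      · exact h
    exact Nat.not_odd_zero (this ▸ hn₆o)
  have h40 : c₄ ≠ 0 := by
    rintro rfl
    simp only [Int.natAbs_zero] at hn₄
    have : n₄ = 0 := by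
      rcases mul_eq_zero.mp hn₄.symm with h | h
      · exact absurd h (pow_ne_zero _ two_ne_zero)
      · exact h
    exact Nat.not_odd_zero (this ▸ hn₄o)
  have sq8 : ∀ {n : ℕ} (e : ℕ), Odd n → ((χ₈ (n : ZMod 8)) ^ e) ^ 2 = 1 := fun e hn ↦ by
    rw [← pow_mul, mul_comm, pow_mul, χ₈_sq_eq_one_of_odd hn, one_pow]
  -- (1) `J(−c₆ | M) = J(−sign c₆ | M) · χ₈(M)^{e₆} · J(n₆ | M)`
  have e6 : -c₆ = -c₆.sign * 2 ^ e₆ * (n₆ : ℤ) := by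
    conv_lhs => rw [d6]
    ring
  have S1 : J(-c₆ | M) = J(-c₆.sign | M) * (χ₈ M) ^ e₆ * J((n₆ : ℤ) | M) := by
    rw [e6, jacobiSym.mul_left, jacobiSym.mul_left, jacobiSym.pow_left, jacobiSym.at_two hMo]
  -- (2) reciprocity `M ↔ n₆`
  have S2 : J((n₆ : ℤ) | M) = qrSign M n₆ * J((M : ℤ) | n₆) := jacobiSym.quadratic_reciprocity' hn₆o hMo
  -- (3) `J(M | n₆) = χ₈(n₆)^v · J(sign Δ | n₆) · J(Δ | n₆)`
  have S3a : J((Δ.natAbs : ℤ) | n₆) = (χ₈ n₆) ^ v * J((M : ℤ) | n₆) := by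
    rw [hM]
    push_cast
    rw [jacobiSym.mul_left, jacobiSym.pow_left, jacobiSym.at_two hn₆o]
  have S3b : J((Δ.natAbs : ℤ) | n₆) = J(Δ.sign | n₆) * J(Δ | n₆) := by
    rw [natAbs_eq_sign_mul Δ, jacobiSym.mul_left]
  have S3 : J((M : ℤ) | n₆) = (χ₈ n₆) ^ v * (J(Δ.sign | n₆) * J(Δ | n₆)) :=
    eq_mul_of_sq_eq_one (sq8 v hn₆o) (S3a.symm.trans S3b)
  -- (4) `J(Δ | n₆) = J(3 | n₆) · J(c₄ | n₆)`
  have e66 : c₄ ^ 3 - c₆ ^ 2 = c₄ ^ 3 + (n₆ : ℤ) * (-(2 ^ (2 * e₆) * n₆)) := by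
    rw [← Int.natAbs_sq c₆, hn₆]
    push_cast
    ring
  have S4a : J(1728 * Δ | n₆) = J(c₄ | n₆) := by
    rw [hΔ, e66, jacobiSym.mod_left, Int.add_mul_emod_self_left, ← jacobiSym.mod_left,
      jacobiSym.pow_left, jacobiSym_pow_three]
  have S4b : J(1728 * Δ | n₆) = J(3 | n₆) * J(Δ | n₆) := by
    rw [jacobiSym.mul_left, show (1728 : ℤ) = 4 ^ 3 * 3 ^ 3 by norm_num, jacobiSym.mul_left,
      jacobiSym.pow_left, jacobiSym.pow_left, jacobiSym.at_four hn₆o, one_pow, one_mul,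
      jacobiSym_pow_three]
  have h3n : ¬ 3 ∣ n₆ := fun h ↦ h63 (Int.ofNat_dvd_left.mpr (hn₆ ▸ Dvd.dvd.mul_left h _))
  have h3sq : J(3 | n₆) ^ 2 = 1 := by
    refine jacobiSym.sq_one ?_
    rw [Int.gcd_eq_natAbs, Int.natAbs_natCast]
    exact (Nat.Prime.coprime_iff_not_dvd Nat.prime_three).mpr h3n
  have S4 : J(Δ | n₆) = J(3 | n₆) * J(c₄ | n₆) := eq_mul_of_sq_eq_one h3sq (S4b.symm.trans S4a)
  -- (5) `J(c₄ | n₆) = J(sign c₄ | n₆) · χ₈(n₆)^{e₄} · qrSign n₆ n₄ · J(n₆ | n₄)`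
  have S5 : J(c₄ | n₆) = J(c₄.sign | n₆) * (χ₈ n₆) ^ e₄ * (qrSign n₆ n₄ * J((n₆ : ℤ) | n₄)) := by
    conv_lhs => rw [d4]
    rw [jacobiSym.mul_left, jacobiSym.mul_left, jacobiSym.pow_left, jacobiSym.at_two hn₆o,
      jacobiSym.quadratic_reciprocity' hn₄o hn₆o]
  -- (6) `J(n₆ | n₄) = J(sign c₆ | n₄) · χ₈(n₄)^{e₆} · χ₈(n₄) · J(G | n₄)`
  have S6a : J(c₆ | n₄) = J(c₆.sign | n₄) * (χ₈ n₄) ^ e₆ * J((n₆ : ℤ) | n₄) := by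
    conv_lhs => rw [d6]
    rw [jacobiSym.mul_left, jacobiSym.mul_left, jacobiSym.pow_left, jacobiSym.at_two hn₄o]
  have S6b : J((n₆ : ℤ) | n₄) = J(c₆.sign | n₄) * (χ₈ n₄) ^ e₆ * J(c₆ | n₄) := by
    refine eq_mul_of_sq_eq_one ?_ (by rw [S6a, mul_assoc])
    rw [mul_pow, jacobiSym_sign_sq h60 hn₄o, sq8 e₆ hn₄o, one_mul]
  have S6c : J(8 * a₁ ^ 2 * c₆ | n₄) = J(G | n₄) := by
    apply jacobiSym.mod_left'
    have hd : (n₄ : ℤ) ∣ 8 * a₁ ^ 2 * c₆ - G :=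
      dvd_trans ⟨c₄.sign * 2 ^ e₄, d4.trans (by ring)⟩ hG
    exact Int.modEq_iff_dvd.mpr (dvd_sub_comm.mp hd)
  have h2cop : IsCoprime (2 : ℤ) n₄ := by
    refine Int.isCoprime_iff_gcd_eq_one.mpr ?_
    rw [Int.gcd_eq_natAbs, Int.natAbs_natCast]
    exact (Nat.Prime.coprime_iff_not_dvd Nat.prime_two).mpr
      fun h ↦ (Nat.not_even_iff_odd.mpr hn₄o) (even_iff_two_dvd.mpr h)
  have hgcd2 : Int.gcd (2 * a₁) (n₄ : ℤ) = 1 :=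
    Int.isCoprime_iff_gcd_eq_one.mp (IsCoprime.mul_left h2cop (Int.isCoprime_iff_gcd_eq_one.mpr ha))
  have S6d : J(8 * a₁ ^ 2 * c₆ | n₄) = χ₈ n₄ * J(c₆ | n₄) := by
    rw [show (8 : ℤ) * a₁ ^ 2 * c₆ = 2 * ((2 * a₁) ^ 2 * c₆) by ring, jacobiSym.mul_left,
      jacobiSym.mul_left, jacobiSym.at_two hn₄o, jacobiSym.sq_one' hgcd2, one_mul]
  have S6e : J(c₆ | n₄) = χ₈ n₄ * J(G | n₄) :=
    eq_mul_of_sq_eq_one (χ₈_sq_eq_one_of_odd hn₄o) (S6d.symm.trans S6c)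
  -- (7) `J(G | n₄) = J(sign G | n₄) · χ₈(n₄)^{eG} · qrSign n₄ nG · J(sign c₄ | nG) · χ₈(nG)^{e₄} · J(c₄ | nG)`
  have S7a : J(c₄ | nG) = J(c₄.sign | nG) * (χ₈ nG) ^ e₄ * J((n₄ : ℤ) | nG) := by
    conv_lhs => rw [d4]
    rw [jacobiSym.mul_left, jacobiSym.mul_left, jacobiSym.pow_left, jacobiSym.at_two hnGo]
  have S7b : J((n₄ : ℤ) | nG) = J(c₄.sign | nG) * (χ₈ nG) ^ e₄ * J(c₄ | nG) := by
    refine eq_mul_of_sq_eq_one ?_ (by rw [S7a, mul_assoc])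
    rw [mul_pow, jacobiSym_sign_sq h40 hnGo, sq8 e₄ hnGo, one_mul]
  have S7 : J(G | n₄) = J(G.sign | n₄) * (χ₈ n₄) ^ eG * (qrSign n₄ nG * J((n₄ : ℤ) | nG)) := by
    conv_lhs => rw [dG]
    rw [jacobiSym.mul_left, jacobiSym.mul_left, jacobiSym.pow_left, jacobiSym.at_two hn₄o,
      jacobiSym.quadratic_reciprocity' hnGo hn₄o]
  -- assemble
  rw [S1, S2, S3, S4, S5, S6b, S6e, S7, S7b]
  ring

/-! ### §3 The `F₂` instance: any parity of `a₁` -/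

/-- For `a ∈ F₂` with `3 ∤ a₁` and no ODD prime dividing both `a₁` and `Q = a₂² + a₂a₂′ + a₂′²`, `a₁` is prime to
the odd part `n₄` of `|c₄(a)|` (`c₄ = a₁(a₁³ − 24a₃) + 48Q`). [folklore] -/
theorem gcd_a₁_oddPart_c₄ (a : Params) {n₄ e₄ : ℕ} (hn₄ : a.curveInt.c₄.natAbs = 2 ^ e₄ * n₄)
    (hn₄o : Odd n₄) (h3 : ¬ (3 : ℤ) ∣ a.a₁)
    (hQ : ∀ p : ℕ, p.Prime → p ≠ 2 → (p : ℤ) ∣ a.a₁ → ¬ (p : ℤ) ∣ a.a₂ ^ 2 + a.a₂ * a.a₂' + a.a₂' ^ 2) :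
    Int.gcd a.a₁ n₄ = 1 := by
  by_contra hne
  obtain ⟨p, hp, hpd⟩ := Nat.exists_prime_and_dvd hne
  have hpa : (p : ℤ) ∣ a.a₁ := dvd_trans (Int.natCast_dvd_natCast.mpr hpd) (Int.gcd_dvd_left _ _)
  have hpn : p ∣ n₄ := by
    have h : (p : ℤ) ∣ (n₄ : ℤ) := dvd_trans (Int.natCast_dvd_natCast.mpr hpd) (Int.gcd_dvd_right _ _)
    exact Int.natCast_dvd_natCast.mp h
  have hp2 : p ≠ 2 := by
    rintro rfl
    exact (Nat.not_even_iff_odd.mpr hn₄o) (even_iff_two_dvd.mpr hpn)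
  have hpc : (p : ℤ) ∣ a.curveInt.c₄ :=
    Int.ofNat_dvd_left.mpr (dvd_trans hpn ⟨2 ^ e₄, by rw [hn₄, mul_comm]⟩)
  have hQ' : (p : ℤ) ∣ 48 * (a.a₂ ^ 2 + a.a₂ * a.a₂' + a.a₂' ^ 2) := by
    have h : 48 * (a.a₂ ^ 2 + a.a₂ * a.a₂' + a.a₂' ^ 2) =
        a.curveInt.c₄ - a.a₁ * (a.a₁ ^ 3 - 24 * a.a₃) := by
      rw [curveInt_c₄]
      ring
    rw [h]
    exact dvd_sub hpc (dvd_mul_of_dvd_left hpa _)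
  have hpZ : Prime (p : ℤ) := Nat.prime_iff_prime_int.mp hp
  rcases hpZ.dvd_or_dvd hQ' with h48 | hQd
  · have h48' : p ∣ 2 ^ 4 * 3 := by exact_mod_cast h48
    rcases (Nat.Prime.dvd_mul hp).mp h48' with h | h
    · exact hp2 ((Nat.prime_dvd_prime_iff_eq hp Nat.prime_two).mp (hp.dvd_of_dvd_pow h))
    · have h3' : p = 3 := (Nat.prime_dvd_prime_iff_eq hp Nat.prime_three).mp h
      subst h3'
      exact h3 hpa
  · exact hQ p hp hp2 hpa hQd

/-- **The Jacobi kernel of `F₂` is Type I — 2-adic general form (any parity of `a₁`).** For `a ∈ F₂` with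
`3 ∤ a₁`, odd-part data `|Δ(a)| = 2^v M`, `|c₆(a)| = 2^{e₆} n₆`, `|c₄(a)| = 2^{e₄} n₄`, `|G(a₁,a₂,a₂′)| = 2^{e_G} n_G`
(`M, n₆, n₄, n_G` odd; `G = a₁⁸ − 288a₁⁴Q − 6912a₁²R − 6912Q²`) and `gcd(a₁, n₄) = 1` (`gcd_a₁_oddPart_c₄`):
`J(−c₆(a) | M) = ε(a) · J(c₄(a) | n_G)` with `ε(a)` the displayed product — a real character of modulus `n_G`
(free of `a₃`) at the linear form `c₄` in `a₃`, times factors depending only on signs, 2-adic exponents and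
residues mod `8` (and `n₆ mod 3`). [cite: Helfgott2004RootNumber, §1] [cite: Rohrlich1993Compositio, Prop. 2(ii)] -/
theorem jacobiSym_neg_c₆_eq_typeI_oddPart (a : Params) {M v n₆ e₆ n₄ e₄ nG eG : ℕ}
    (hM : a.curveInt.Δ.natAbs = 2 ^ v * M) (hMo : Odd M)
    (hn₆ : a.curveInt.c₆.natAbs = 2 ^ e₆ * n₆) (hn₆o : Odd n₆)
    (hn₄ : a.curveInt.c₄.natAbs = 2 ^ e₄ * n₄) (hn₄o : Odd n₄)
    (hnG : (a.a₁ ^ 8 - 288 * a.a₁ ^ 4 * (a.a₂ ^ 2 + a.a₂ * a.a₂' + a.a₂' ^ 2)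
            - 6912 * a.a₁ ^ 2 * (a.a₂ * a.a₂' * (a.a₂ + a.a₂'))
            - 6912 * (a.a₂ ^ 2 + a.a₂ * a.a₂' + a.a₂' ^ 2) ^ 2).natAbs = 2 ^ eG * nG) (hnGo : Odd nG)
    (h3 : ¬ (3 : ℤ) ∣ a.a₁) (ha : Int.gcd a.a₁ n₄ = 1) :
    J(-a.curveInt.c₆ | M) =
      J(-a.curveInt.c₆.sign | M) * (χ₈ M) ^ e₆ * qrSign M n₆ * (χ₈ n₆) ^ v *
        J(a.curveInt.Δ.sign | n₆) * J(3 | n₆) * J(a.curveInt.c₄.sign | n₆) * (χ₈ n₆) ^ e₄ * qrSign n₆ n₄ *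
        J(a.curveInt.c₆.sign | n₄) * (χ₈ n₄) ^ e₆ * χ₈ n₄ *
        J((a.a₁ ^ 8 - 288 * a.a₁ ^ 4 * (a.a₂ ^ 2 + a.a₂ * a.a₂' + a.a₂' ^ 2)
            - 6912 * a.a₁ ^ 2 * (a.a₂ * a.a₂' * (a.a₂ + a.a₂'))
            - 6912 * (a.a₂ ^ 2 + a.a₂ * a.a₂' + a.a₂' ^ 2) ^ 2).sign | n₄) * (χ₈ n₄) ^ eG * qrSign n₄ nG *
        J(a.curveInt.c₄.sign | nG) * (χ₈ nG) ^ e₄ * J(a.curveInt.c₄ | nG) :=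
  jacobiSym_neg_transfer_oddPart a.curveInt.c_relation ⟨9 * (8 * a.a₁ * a.a₃ - a.a₁ ^ 4
      + 16 * (a.a₂ ^ 2 + a.a₂ * a.a₂' + a.a₂' ^ 2)), by rw [eight_mul_a₁_sq_mul_c₆]; ring⟩ hM hMo hn₆ hn₆o
    (not_three_dvd_curveInt_c₆ a h3) hn₄ hn₄o hnG hnGo ha

/-! ### §4 The root number on the squarefree locus, 2-adic general form -/

/-- **Type-I normal form of the root number, odd squarefree `Δ`, any parity of `a₁`** (modulo Modularity):
`w(E_a) = −μ(|Δ|)·ε(a)·J(c₄(a) | n_G)` with the data and the explicit `ε` of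
`jacobiSym_neg_c₆_eq_typeI_oddPart` at `M = |Δ|`, `v = 0`. On the squarefree locus `a₁` even forces `Δ` odd
(`not_two_dvd_a₁_mul_a₃`), so this covers the `a₁`-even half of the door class.
[cite: Rohrlich1993Compositio, Prop. 2(ii)] [cite: Helfgott2004RootNumber, §1] -/
theorem rootNumber_curve_eq_typeI_oddPart_of_odd (a : Params) (hsq : Squarefree a.curveInt.Δ)
    (hodd : ¬ (2 : ℤ) ∣ a.curveInt.Δ) {n₆ e₆ n₄ e₄ nG eG : ℕ}
    (hn₆ : a.curveInt.c₆.natAbs = 2 ^ e₆ * n₆) (hn₆o : Odd n₆)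
    (hn₄ : a.curveInt.c₄.natAbs = 2 ^ e₄ * n₄) (hn₄o : Odd n₄)
    (hnG : (a.a₁ ^ 8 - 288 * a.a₁ ^ 4 * (a.a₂ ^ 2 + a.a₂ * a.a₂' + a.a₂' ^ 2)
            - 6912 * a.a₁ ^ 2 * (a.a₂ * a.a₂' * (a.a₂ + a.a₂'))
            - 6912 * (a.a₂ ^ 2 + a.a₂ * a.a₂' + a.a₂' ^ 2) ^ 2).natAbs = 2 ^ eG * nG) (hnGo : Odd nG)
    (h3 : ¬ (3 : ℤ) ∣ a.a₁) (ha : Int.gcd a.a₁ n₄ = 1)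
    (hmod : Literature.NumberTheory.EllipticCurves.ModularForms.exists_isNewformOf) :
    a.curve.rootNumber =
      -(ArithmeticFunction.moebius a.curveInt.Δ.natAbs *
        (J(-a.curveInt.c₆.sign | a.curveInt.Δ.natAbs) * (χ₈ a.curveInt.Δ.natAbs) ^ e₆ *
          qrSign a.curveInt.Δ.natAbs n₆ *
          J(a.curveInt.Δ.sign | n₆) * J(3 | n₆) * J(a.curveInt.c₄.sign | n₆) * (χ₈ n₆) ^ e₄ * qrSign n₆ n₄ *
          J(a.curveInt.c₆.sign | n₄) * (χ₈ n₄) ^ e₆ * χ₈ n₄ *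
          J((a.a₁ ^ 8 - 288 * a.a₁ ^ 4 * (a.a₂ ^ 2 + a.a₂ * a.a₂' + a.a₂' ^ 2)
            - 6912 * a.a₁ ^ 2 * (a.a₂ * a.a₂' * (a.a₂ + a.a₂'))
            - 6912 * (a.a₂ ^ 2 + a.a₂ * a.a₂' + a.a₂' ^ 2) ^ 2).sign | n₄) * (χ₈ n₄) ^ eG * qrSign n₄ nG *
          J(a.curveInt.c₄.sign | nG) * (χ₈ nG) ^ e₄ * J(a.curveInt.c₄ | nG))) := by
  have hMo : Odd a.curveInt.Δ.natAbs := Int.natAbs_odd.mpr (Int.odd_iff.mpr (by omega))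
  have h := jacobiSym_neg_c₆_eq_typeI_oddPart a (M := a.curveInt.Δ.natAbs) (v := 0) (by simp) hMo
    hn₆ hn₆o hn₄ hn₄o hnG hnGo h3 ha
  rw [pow_zero, mul_one] at h
  rw [rootNumber_curve_eq_neg_moebius_mul_jacobiSym_of_odd a hsq hodd hmod, h]

/-- **Type-I normal form of the root number, even squarefree `Δ`, 2-adic general form** (`2 ∥ Δ`; modulo
Modularity): with `m = |Δ|/2`, `w(E_a) = −μ(m)·ε(a)·J(c₄(a) | n_G)`, `ε` at `M = m`, `v = 1`.
[cite: Rohrlich1993Compositio, Prop. 2(ii)] [cite: Helfgott2004RootNumber, §1] -/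
theorem rootNumber_curve_eq_typeI_oddPart_of_even (a : Params) (hsq : Squarefree a.curveInt.Δ)
    (heven : (2 : ℤ) ∣ a.curveInt.Δ) {n₆ e₆ n₄ e₄ nG eG : ℕ}
    (hn₆ : a.curveInt.c₆.natAbs = 2 ^ e₆ * n₆) (hn₆o : Odd n₆)
    (hn₄ : a.curveInt.c₄.natAbs = 2 ^ e₄ * n₄) (hn₄o : Odd n₄)
    (hnG : (a.a₁ ^ 8 - 288 * a.a₁ ^ 4 * (a.a₂ ^ 2 + a.a₂ * a.a₂' + a.a₂' ^ 2)
            - 6912 * a.a₁ ^ 2 * (a.a₂ * a.a₂' * (a.a₂ + a.a₂'))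
            - 6912 * (a.a₂ ^ 2 + a.a₂ * a.a₂' + a.a₂' ^ 2) ^ 2).natAbs = 2 ^ eG * nG) (hnGo : Odd nG)
    (h3 : ¬ (3 : ℤ) ∣ a.a₁) (ha : Int.gcd a.a₁ n₄ = 1)
    (hmod : Literature.NumberTheory.EllipticCurves.ModularForms.exists_isNewformOf) :
    a.curve.rootNumber =
      -(ArithmeticFunction.moebius (a.curveInt.Δ.natAbs / 2) *
        (J(-a.curveInt.c₆.sign | a.curveInt.Δ.natAbs / 2) * (χ₈ ((a.curveInt.Δ.natAbs / 2 : ℕ) : ZMod 8)) ^ e₆ *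
          qrSign (a.curveInt.Δ.natAbs / 2) n₆ * χ₈ n₆ *
          J(a.curveInt.Δ.sign | n₆) * J(3 | n₆) * J(a.curveInt.c₄.sign | n₆) * (χ₈ n₆) ^ e₄ * qrSign n₆ n₄ *
          J(a.curveInt.c₆.sign | n₄) * (χ₈ n₄) ^ e₆ * χ₈ n₄ *
          J((a.a₁ ^ 8 - 288 * a.a₁ ^ 4 * (a.a₂ ^ 2 + a.a₂ * a.a₂' + a.a₂' ^ 2)
            - 6912 * a.a₁ ^ 2 * (a.a₂ * a.a₂' * (a.a₂ + a.a₂'))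
            - 6912 * (a.a₂ ^ 2 + a.a₂ * a.a₂' + a.a₂' ^ 2) ^ 2).sign | n₄) * (χ₈ n₄) ^ eG * qrSign n₄ nG *
          J(a.curveInt.c₄.sign | nG) * (χ₈ nG) ^ e₄ * J(a.curveInt.c₄ | nG))) := by
  obtain ⟨M, hM⟩ : 2 ∣ a.curveInt.Δ.natAbs := Int.natCast_dvd.mp heven
  have hdiv : a.curveInt.Δ.natAbs / 2 = M := by rw [hM]; simp
  have hMo : Odd M := by
    refine Nat.odd_iff.mpr (Nat.two_dvd_ne_zero.mp fun h2 ↦ ?_)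
    obtain ⟨k, hk⟩ := h2
    have h4 : (2 : ℤ) * 2 ∣ a.curveInt.Δ := by
      refine Int.natAbs_dvd_natAbs.mp ?_
      exact ⟨k, by rw [hM, hk]; simp; ring⟩
    exact Int.prime_two.not_unit (hsq 2 h4)
  have h := jacobiSym_neg_c₆_eq_typeI_oddPart a (M := M) (v := 1) (by rw [hM, pow_one]) hMo
    hn₆ hn₆o hn₄ hn₄o hnG hnGo h3 ha
  rw [pow_one] at h
  rw [rootNumber_curve_eq_neg_moebius_mul_jacobiSym_of_even a hsq heven hmod, hdiv, h]

end Summit.BirchSwinnertonDyer.BirchSwinnertonDyer.Theorems.F2RootNumber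

end
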